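import Summits.AtomisticToContinuum.Crystallization.Theorems.FrustratedLawDichotomyStrainedPatchStretchRowsA

/-!
# «StretchRows / InteriorChain / KinkVoid» (lens-5 g67, 27623 T-side) — part 2 of 2 (sequel of `…FrustratedLawDichotomyStrainedPatchStretchRowsA`)

Split for the 400-line cap by the landing lane (hand-2 g31); the module docstring of part 1 (`…FrustratedLawDichotomyStrainedPatchStretchRowsA`) describes the whole node.  Same namespace; all FQNs unchanged.
0 sorry; standard axioms.
-/


namespace Summit.AtomisticToContinuum.Crystallization.Theorems.FrustratedLawDichotomyStrainedPatchStretchRows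

open scoped BigOperators Classical RealInnerProductSpace
open Summit.AtomisticToContinuum.Crystallization.Theorems.FrustratedLawDichotomyMotifLemmas
open Summit.AtomisticToContinuum.Crystallization.Theorems.FrustratedLawDichotomyAveragingCut
open Summit.AtomisticToContinuum.Crystallization.Theorems.FrustratedLawDichotomyStrainedPatchHomSplit
open Summit.AtomisticToContinuum.Crystallization.Theorems.FrustratedLawDichotomyStrainedPatchCleanCollar
open Summit.AtomisticToContinuum.Crystallization.Theorems.FrustratedLawDichotomyStrainedPatchPhaseCut
open Summit.AtomisticToContinuum.Crystallization.Theorems.FrustratedLawDichotomyStrainedPatchCoreTube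
open Summit.AtomisticToContinuum.Crystallization.Theorems.FrustratedLawDichotomyStrainedPatchAugmentedEnvelope
open Summit.AtomisticToContinuum.Crystallization.Theorems.FrustratedLawDichotomyStrainedPatchEnvelopeLaw
open Summit.AtomisticToContinuum.Crystallization.Theorems.FrustratedLawDichotomyStrainedPatchEnvelopeTaylor
open Summit.AtomisticToContinuum.Crystallization.Theorems.FrustratedLawDichotomyStrainedPatchChartFamilies
open Summit.AtomisticToContinuum.Crystallization.Theorems.FrustratedLawDichotomyStrainedPatchQuantSlaving
open Summit.AtomisticToContinuum.Crystallization.Theorems.FrustratedLawDichotomyStrainedPatchHostCells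
open Summit.AtomisticToContinuum.Crystallization.Theorems.FrustratedLawDichotomyStrainedPatchForceCap
open Summit.AtomisticToContinuum.Crystallization.Theorems.FrustratedLawDichotomyStrainedPatchRobustRows

/-! ## §3. Stretch-aware sound rows, the certificate format they make sound at the a-priori texture, and the junction to (TF) -/

/-- **`sqStretch kr z c z₀ e a`** — the RADIALLY WEIGHTED squared BOND-LENGTH CHANGES at `a` against the reference, over move-test neighbours inside the
charted ball: `Σ_b kr(|z₀ (e a) − z₀ (e b)|)·(|z a − z b| − |z₀ (e a) − z₀ (e b)|)²`, the weight `kr : ℝ → ℝ` a fixed function of the REFERENCE bond length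
(`kr(r) ≈ ½(1+β)·sup_{|r'−r| ≤ 2τ}|φ''(r')r'|`, `φ = V'/r = −r⁻¹⁴ + r⁻⁸`: `≈ 108` at `r = 1` (`τ = 1/80`), `≈ 1` at `√2`, `< 0.3` beyond — nearest-neighbour
supported; `β > 0` the Young split of the end-point-stretch comparison, its partner `(1+1/β)m⁴/r₀²` going to `K_ang`; the β-free secant-in-r organisation
— expand `V'(r)` to second order in the EXACT stretch with Lagrange remainder `½V‴(ξ)s²`, the direction `x̂` to second order in `Δ` — gives `kr = ½sup|V‴| ≈ 98` at `1`, memo §3).  This is the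
functional the certificate's exact secant ENERGY floors control bond by bond. -/
noncomputable def sqStretch (kr : ℝ → ℝ) {M : ℕ} (z : Fin M → E3) (c : Fin M) {M₀ : ℕ} (z₀ : Fin M₀ → E3) (e : Fin M → Fin M₀) (a : Fin M) : ℝ :=
  ∑ b ∈ moveNbrs 7 z a ∩ ball (63 / 10) z c, kr (dist (z₀ (e a)) (z₀ (e b))) * (dist (z a) (z b) - dist (z₀ (e a)) (z₀ (e b))) ^ 2

/-- **`radWeight kr z c z₀ e a`** — the total radial weight `Σ_b kr(|z₀ (e a) − z₀ (e b)|)` of the bonds at `a` (`≈ 12·108 + 6·1 + 24·0.23 + … ≈ 1.3·10³` at an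
fcc site, `τ = 1/80`). -/
noncomputable def radWeight (kr : ℝ → ℝ) {M : ℕ} (z : Fin M → E3) (c : Fin M) {M₀ : ℕ} (z₀ : Fin M₀ → E3) (e : Fin M → Fin M₀) (a : Fin M) : ℝ :=
  ∑ b ∈ moveNbrs 7 z a ∩ ball (63 / 10) z c, kr (dist (z₀ (e a)) (z₀ (e b)))

/-- `0 ≤ sqStretch` for a non-negative weight. [formal bookkeeping] -/
theorem sqStretch_nonneg {kr : ℝ → ℝ} (hkr : ∀ r, 0 ≤ kr r) {M : ℕ} (z : Fin M → E3) (c : Fin M) {M₀ : ℕ} (z₀ : Fin M₀ → E3) (e : Fin M → Fin M₀)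
    (a : Fin M) : 0 ≤ sqStretch kr z c z₀ e a :=
  Finset.sum_nonneg fun _ _ => mul_nonneg (hkr _) (sq_nonneg _)

/-- A bond-length change is at most the bond's relative texture (reverse triangle inequality). [formal bookkeeping] -/
theorem abs_stretch_le_relTex {M : ℕ} (z : Fin M → E3) (c : Fin M) {M₀ : ℕ} (z₀ : Fin M₀ → E3) (c₀ : Fin M₀) (e : Fin M → Fin M₀) (a b : Fin M) :
    |dist (z a) (z b) - dist (z₀ (e a)) (z₀ (e b))| ≤ relTex z c z₀ c₀ e a b := by
  rw [dist_eq_norm, dist_eq_norm]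
  refine (abs_norm_sub_norm_le _ _).trans (le_of_eq ?_)
  unfold relTex dev
  rw [← norm_neg]
  congr 1
  abel

/-- Texture `≤ m` at `a` bounds `sqStretch kr a ≤ radWeight kr a · m²`; so (SR) implies 66R's (ROW∇) with `K = K_ang + K_rad`, `K_rad ≥ radWeight` — and
(ROW∇)'s structure-free constant is dominated by that radial part (memo §2: `≈ 90 %` of `K ≈ 1186` at `1/80`). [formal bookkeeping] -/
theorem sqStretch_le_radWeight_mul_sq {kr : ℝ → ℝ} (hkr : ∀ r, 0 ≤ kr r) {M : ℕ} {z : Fin M → E3} {c : Fin M} {M₀ : ℕ} {z₀ : Fin M₀ → E3} {c₀ : Fin M₀}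
    {e : Fin M → Fin M₀} {a : Fin M} {m : ℝ} (h : ∀ b ∈ moveNbrs 7 z a, b ∈ ball (63 / 10) z c → relTex z c z₀ c₀ e a b ≤ m) :
    sqStretch kr z c z₀ e a ≤ radWeight kr z c z₀ e a * m ^ 2 := by
  unfold sqStretch radWeight
  rw [Finset.sum_mul]
  refine Finset.sum_le_sum fun b hb => mul_le_mul_of_nonneg_left ?_ (hkr _)
  rw [Finset.mem_inter] at hb
  have h1 := (abs_stretch_le_relTex z c z₀ c₀ e a b).trans (h b hb.1 hb.2)
  have h2 := pow_le_pow_left₀ (abs_nonneg _) h1 2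
  rwa [sq_abs] at h2

/-- ★★ **(SR) `StretchRowEnclosure 𝓘 τ Kang kr H F X`** [ANALYTIC · ATTACKABLE (M): integral-remainder Taylor of each pair force `f_b(x) = −φ(|x|)x` along the
segment, the RADIAL term `−φ''(r_t)(x̂_t·Δ)²x_t` bounded through the monotonicity of `t ↦ x̂_t·Δ` by the END-POINT stretch, `(x̂_t·Δ)² ≤ (1+β)s_b² + (1+1/β)m⁴/r₀²`,
everything else by `m²`] — at every reach site of a `τ`-chart with local texture `≤ m`: `‖F_a − ℓ_a‖ ≤ K_ang(e a)·m² + sqStretch kr a + X(e a)`, with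
`K_ang = ½Σ_b sup_tube(‖D²f_b[h,h]‖ minus its radial term) ≈ 131` at `τ = 1/80` for the plain split, `≈ 63` for the secant-in-r split (memo §3), `kr` as at `sqStretch`, `X` = 57Q's unmodelled column.
Compare 66R's structure-free (ROW∇): ONE constant `K ≈ 1186` (`1/80`) carrying both parts, `≈ 90 %` of it radial. -/
def StretchRowEnclosure (𝓘 : ChartFam) (τ : ℝ) (Kang : SlackTab) (kr : ℝ → ℝ) (H : HessTab) (F : ForceTab) (X : SlackTab) : Prop :=
  ∀ (M : ℕ) (z : Fin M → E3) (c : Fin M) (M₀ : ℕ) (z₀ : Fin M₀ → E3) (c₀ : Fin M₀) (e : Fin M → Fin M₀) (m : ℝ),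
    Admissible M z c → CleanBall (63 / 10) z c → MonoPhaseBall (63 / 10) z c → ChartBy 𝓘 τ τ z c z₀ c₀ e → 0 ≤ m →
      ∀ a ∈ ball (63 / 10) z c, IsReach z c a → (∀ b ∈ moveNbrs 7 z a, b ∈ ball (63 / 10) z c → relTex z c z₀ c₀ e a b ≤ m) →
        ‖siteForce 7 z a - linForce H F z c z₀ c₀ e a‖ ≤ Kang M₀ z₀ c₀ (e a) * m ^ 2 + sqStretch kr z c z₀ e a + X M₀ z₀ c₀ (e a)

/-- **`RadBound 𝓘 τ kr Krad`** [GEOMETRIC · KNOWN-MATH from separation on clean balls and the decay of `kr`] — the total radial weight at a reach site of a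
chart is at most the instance's table value `K_rad(e a)`. -/
def RadBound (𝓘 : ChartFam) (τ : ℝ) (kr : ℝ → ℝ) (Krad : SlackTab) : Prop :=
  ∀ (M : ℕ) (z : Fin M → E3) (c : Fin M) (M₀ : ℕ) (z₀ : Fin M₀ → E3) (c₀ : Fin M₀) (e : Fin M → Fin M₀),
    Admissible M z c → CleanBall (63 / 10) z c → MonoPhaseBall (63 / 10) z c → ChartBy 𝓘 τ τ z c z₀ c₀ e →
      ∀ a ∈ ball (63 / 10) z c, IsReach z c a → radWeight kr z c z₀ e a ≤ Krad M₀ z₀ c₀ (e a)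

/-- ★ (SR) ∧ (RadBound) ⟹ 66R's (ROW∇) with `K = K_ang + K_rad` — the stretch-aware bound REFINES the structure-free one. [formal bookkeeping] -/
theorem forceRowEnclosure_of_stretch {𝓘 : ChartFam} {τ : ℝ} {Kang Krad : SlackTab} {kr : ℝ → ℝ} {H : HessTab} {F : ForceTab} {X : SlackTab}
    (hS : StretchRowEnclosure 𝓘 τ Kang kr H F X) (hkr : ∀ r, 0 ≤ kr r) (hK : RadBound 𝓘 τ kr Krad) :
    ForceRowEnclosure 𝓘 τ (fun M₀ z₀ c₀ b => Kang M₀ z₀ c₀ b + Krad M₀ z₀ c₀ b) H F X := by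
  intro M z c M₀ z₀ c₀ e m hz hcl hmo hch hm a ha hr htex
  have h := hS M z c M₀ z₀ c₀ e m hz hcl hmo hch hm a ha hr htex
  have hq := sqStretch_le_radWeight_mul_sq hkr htex (kr := kr) (z₀ := z₀) (e := e)
  have hc : radWeight kr z c z₀ e a * m ^ 2 ≤ Krad M₀ z₀ c₀ (e a) * m ^ 2 :=
    mul_le_mul_of_nonneg_right (hK M z c M₀ z₀ c₀ e hz hcl hmo hch a ha hr) (sq_nonneg m)
  have he : (Kang M₀ z₀ c₀ (e a) + Krad M₀ z₀ c₀ (e a)) * m ^ 2 = Kang M₀ z₀ c₀ (e a) * m ^ 2 + Krad M₀ z₀ c₀ (e a) * m ^ 2 := by ring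
  rw [he]
  linarith

/-- ★★ **(FT∇ˢʳ) `StretchTubeCert 𝓘 τ σ Kang kr H F X`** [FINITE RANGE · INSTRUMENTABLE FORMAT — the robust AUG engine with rows priced at the A-PRIORI
texture `2τ`: slack `σ + X + K_ang(2τ)²` (`≈ 4.6–8.6σ₁ + X` at `1/80`, `3.3–5.3σ₁` at `1/100`, `2.7–3.9σ₁` at `1/118`, split-dependent), the term `sqStretch kr` CHARGED to the exact
secant energy floors (§4) · EQUIVALENT to (TF) given (FC σ) and (SR) (`stretchTubeCert_iff`): its content is the soundness format, not a weakening] — every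
admissible clean mono-phase `τ`-chart whose reach sites obey the force cap and the stretch-aware row enclosure scores `≥ 0`. -/
def StretchTubeCert (𝓘 : ChartFam) (τ σ : ℝ) (Kang : SlackTab) (kr : ℝ → ℝ) (H : HessTab) (F : ForceTab) (X : SlackTab) : Prop :=
  ∀ (M : ℕ) (z : Fin M → E3) (c : Fin M) (M₀ : ℕ) (z₀ : Fin M₀ → E3) (c₀ : Fin M₀) (e : Fin M → Fin M₀),
    Admissible M z c → CleanBall (63 / 10) z c → MonoPhaseBall (63 / 10) z c → ChartBy 𝓘 τ τ z c z₀ c₀ e →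
      (∀ a ∈ ball (63 / 10) z c, IsReach z c a →
          ‖siteForce 7 z a‖ ≤ σ ∧
            ‖siteForce 7 z a - linForce H F z c z₀ c₀ e a‖ ≤ Kang M₀ z₀ c₀ (e a) * (2 * τ) ^ 2 + sqStretch kr z c z₀ e a + X M₀ z₀ c₀ (e a)) →
        0 ≤ ballAvg (9 / 5) z (xRec M z) c

/-- `0 ≤ τ` on any chart (the centre is charted). [formal bookkeeping] -/
theorem tau_nonneg_of_chartBy {𝓘 : ChartFam} {τ t : ℝ} {M : ℕ} {z : Fin M → E3} {c : Fin M} {M₀ : ℕ} {z₀ : Fin M₀ → E3} {c₀ : Fin M₀}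
    {e : Fin M → Fin M₀} (hch : ChartBy 𝓘 τ t z c z₀ c₀ e) : 0 ≤ τ :=
  (norm_nonneg _).trans (norm_dev_le_of_chartBy hch (self_mem_ball (by norm_num) z c))

/-- ★★★ **THE JUNCTION OF THIS NODE — (FC σ) ∧ (SR) ∧ (FT∇ˢʳ) ⟹ (TF).**  No texture theorem: the rows are priced at the a-priori texture `2τ`
(`relTexture_two_tau`), which the stretch-aware split makes affordable. -/
theorem tubeFloor_of_stretchCert {𝓘 : ChartFam} {τ σ : ℝ} {Kang : SlackTab} {kr : ℝ → ℝ} {H : HessTab} {F : ForceTab} {X : SlackTab}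
    (hF : ForceCapLaw σ) (hS : StretchRowEnclosure 𝓘 τ Kang kr H F X) (hC : StretchTubeCert 𝓘 τ σ Kang kr H F X) : TubeFloor 𝓘 τ := by
  intro M z c M₀ z₀ c₀ e hz hcl hmo hch
  refine hC M z c M₀ z₀ c₀ e hz hcl hmo hch fun a ha hr => ⟨hF M z c hz a hr, ?_⟩
  have hτ : 0 ≤ 2 * τ := by linarith [tau_nonneg_of_chartBy hch]
  exact hS M z c M₀ z₀ c₀ e (2 * τ) hz hcl hmo hch hτ a ha hr (relTexture_two_tau 𝓘 τ M z c M₀ z₀ c₀ e hz hcl hmo hch a ha hr)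

/-- Conversely (TF) ⟹ (FT∇ˢʳ). [formal bookkeeping] -/
theorem stretchTubeCert_of_tubeFloor {𝓘 : ChartFam} {τ σ : ℝ} {Kang : SlackTab} {kr : ℝ → ℝ} {H : HessTab} {F : ForceTab} {X : SlackTab} (h : TubeFloor 𝓘 τ) :
    StretchTubeCert 𝓘 τ σ Kang kr H F X :=
  fun M z c M₀ z₀ c₀ e hz hcl hmo hch _ => h M z c M₀ z₀ c₀ e hz hcl hmo hch

/-- (FT∇ˢʳ) ⟺ (TF) given (FC σ) and (SR): the format is sound and complete. [formal bookkeeping] -/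
theorem stretchTubeCert_iff {𝓘 : ChartFam} {τ σ : ℝ} {Kang : SlackTab} {kr : ℝ → ℝ} {H : HessTab} {F : ForceTab} {X : SlackTab} (hF : ForceCapLaw σ)
    (hS : StretchRowEnclosure 𝓘 τ Kang kr H F X) : StretchTubeCert 𝓘 τ σ Kang kr H F X ↔ TubeFloor 𝓘 τ :=
  ⟨tubeFloor_of_stretchCert hF hS, stretchTubeCert_of_tubeFloor⟩

/-- (FT∇ˢʳ) also yields 66R's robust certificate at the a-priori texture, hence at every `m ≤ 2τ`. [formal bookkeeping] -/
theorem robustTubeCert_of_stretchCert {𝓘 : ChartFam} {τ σ : ℝ} {Kang : SlackTab} {kr : ℝ → ℝ} {H : HessTab} {F : ForceTab} {X : SlackTab} (hF : ForceCapLaw σ)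
    (hS : StretchRowEnclosure 𝓘 τ Kang kr H F X) (hC : StretchTubeCert 𝓘 τ σ Kang kr H F X) (m : ℝ) : RobustTubeCert 𝓘 τ m :=
  robustTubeCert_of_tubeFloor (tubeFloor_of_stretchCert hF hS hC) m

/-! ## §4. The replay target: robust rows with the stretch-aware error functional — a constant `E₀` plus a CHARGED quadratic stretch functional `Q` -/

section Replay

variable {V : Type*} [NormedAddCommGroup V]

/-- One row's error: `‖F − ℓ‖ ≤ A + k·q` with `0 ≤ q ≤ q̄` gives `‖F − ℓ‖² ≤ A² + (2Ak + k²q̄)·q` — LINEAR in the stretch functional `q` (no sign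
conditions on `A`, `k`). [folklore] -/
theorem errSq_le_linear {A k q qbar d : ℝ} (hq : 0 ≤ q) (hqb : q ≤ qbar) (hd0 : 0 ≤ d) (hd : d ≤ A + k * q) :
    d ^ 2 ≤ A ^ 2 + (2 * A * k + k ^ 2 * qbar) * q := by
  have h1 : d ^ 2 ≤ (A + k * q) ^ 2 := pow_le_pow_left₀ hd0 hd 2
  have h2 : k ^ 2 * q ^ 2 ≤ k ^ 2 * qbar * q := by nlinarith [mul_nonneg (sq_nonneg k) hq, mul_le_mul_of_nonneg_left hqb (mul_nonneg (sq_nonneg k) hq)]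
  nlinarith

/-- ★★ **LAGRANGIAN DOMINANCE WITH STRETCH-AWARE SOUND ROWS** (the `hdom` of 60A's schema, PROVED): on the force-capped class, with multipliers `ν ≥ 0`,
one `θ ∈ (0,1]`, ANY linearisation `ℓ`, row enclosures `‖F_a − ℓ_a‖ ≤ A_a + k_a·q_a(z)` and `0 ≤ q_a(z) ≤ q̄_a` (any real `A_a`, `k_a`):
`S z − σ²Σν + Σ ν_a(1−θ)‖ℓ_a z‖² − E₀ − Q z ≤ S z` with the CONSTANT `E₀ = Σ ν_a((1−θ)/θ)A_a²` and the CHARGED STRETCH FUNCTIONAL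
`Q z = Σ ν_a((1−θ)/θ)(2A_a k_a + k_a² q̄_a)·q_a z` (to be subtracted from the model's secant curvature budget, bond by bond). [folklore] -/
theorem score_dominates_stretch_rows {ι X : Type*} (s : Finset ι) (S : X → ℝ) {ν A k qbar : ι → ℝ} {σ θ : ℝ} (F ℓ : ι → X → V) (q : ι → X → ℝ)
    {z : X} (hν : ∀ a ∈ s, 0 ≤ ν a) (h0 : 0 < θ) (h1 : θ ≤ 1) (hcap : ∀ a ∈ s, ‖F a z‖ ≤ σ) (hq : ∀ a ∈ s, 0 ≤ q a z ∧ q a z ≤ qbar a)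
    (henc : ∀ a ∈ s, ‖F a z - ℓ a z‖ ≤ A a + k a * q a z) :
    S z - σ ^ 2 * ∑ a ∈ s, ν a + ∑ a ∈ s, ν a * ((1 - θ) * ‖ℓ a z‖ ^ 2) - ∑ a ∈ s, ν a * ((1 - θ) / θ * A a ^ 2) -
        ∑ a ∈ s, ν a * ((1 - θ) / θ * (2 * A a * k a + k a ^ 2 * qbar a)) * q a z ≤ S z := by
  have hrr := score_dominates_robust_rows s S F ℓ (σ := σ) hν h0 h1 hcap (z := z)
  have hθ : 0 ≤ (1 - θ) / θ := div_nonneg (by linarith) h0.le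
  have hterm : ∀ a ∈ s, ν a * ((1 - θ) * ‖ℓ a z‖ ^ 2) - ν a * ((1 - θ) / θ * A a ^ 2) - ν a * ((1 - θ) / θ * (2 * A a * k a + k a ^ 2 * qbar a)) * q a z ≤
      ν a * ((1 - θ) * ‖ℓ a z‖ ^ 2 - (1 - θ) / θ * ‖F a z - ℓ a z‖ ^ 2) := by
    intro a ha
    have hb := errSq_le_linear (hq a ha).1 (hq a ha).2 (norm_nonneg _) (henc a ha)
    have hc : 0 ≤ ν a * ((1 - θ) / θ) := mul_nonneg (hν a ha) hθ
    nlinarith [mul_le_mul_of_nonneg_left hb hc]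
  have hsum := Finset.sum_le_sum hterm
  rw [Finset.sum_sub_distrib, Finset.sum_sub_distrib] at hsum
  linarith

/-- ★ **THE REPLAY TARGET `ChargedMinorant T Smod Q z₀ w g lam`** [INSTRUMENTABLE — what a rational replay of one cell must establish: the quadratic model
of the CHARGED augmented score `Smod − Q` (secant energy floors with the stretch charges `c_a` removed from the bond curvatures, exact linear rows
`(1−θ)ν‖ℓ‖²`, exact tube / window rows) minorises it on the tube with curvature `lam > 0`; kernel-side: `H̃ − lam·I = LᵀDL`, `D ≥ 0`, rational]. -/
def ChargedMinorant {X : Type*} [InnerProductSpace ℝ V] (T : Set X) (Smod Q : X → ℝ) (z₀ : X) (w : X → V) (g : V) (lam : ℝ) : Prop :=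
  ∀ z ∈ T, Smod z₀ - Q z₀ + ⟪g, w z⟫ + lam / 2 * ‖w z‖ ^ 2 ≤ Smod z - Q z

/-- ★★ **THE STRETCH CERTIFICATE = 60A's schema instantiated with the explicit error functional** (`Err ≡ E₀ + Q`, `Q` charged into the model): dominance
`Smod − E₀ − Q ≤ S` on the admissible class `A ⊆ T` (from `score_dominates_stretch_rows`) and the charged minorant on the tube give the floor
`Smod z₀ − E₀ − Q z₀ − ‖g‖²/(2·lam) ≤ S` on `A`.  This is the fixed Lean signature of «rational replay» before numbers arrive (row 1129 (f)). [folklore] -/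
theorem stretch_certificate {X : Type*} [InnerProductSpace ℝ V] {A T : Set X} (hAT : A ⊆ T) (S Smod Q : X → ℝ) (E₀ : ℝ) (z₀ : X) (w : X → V)
    (g : V) {lam : ℝ} (hlam : 0 < lam) (hdom : ∀ z ∈ A, Smod z - E₀ - Q z ≤ S z) (hmin : ChargedMinorant T Smod Q z₀ w g lam) :
    ∀ z ∈ A, Smod z₀ - E₀ - Q z₀ - ‖g‖ ^ 2 / (2 * lam) ≤ S z :=
  certificate_schema hAT S (fun z => Smod z - E₀ - Q z) z₀ w g hlam hdom fun z hz =>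
    show Smod z₀ - E₀ - Q z₀ + ⟪g, w z⟫ + lam / 2 * ‖w z‖ ^ 2 ≤ Smod z - E₀ - Q z by linarith [hmin z hz]

end Replay

/-! ## §5. Records at the line of record (61H currency) and at a general cover tolerance -/

/-- ★★★ **RECORD (stretch path, `τ = 1/80`).**  [CORE-FAR] ⟸ (FC σ₁) [PROVED, tree `forceCapOne`] ∧ (SR) `StretchRowEnclosure FamP (1/80) …` [ANALYTIC·
ATTACKABLE (M)] ∧ (FT∇ˢʳ) `StretchTubeCert FamP (1/80) σ₁ …` [INSTRUMENTABLE: AUG-67sr] ∧ (BC)ᴾ `CoverP` [INSTRUMENTABLE ✓ BUDGET-T1 passes, row 1132]. -/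
theorem coreOff_record_g67 {Kang : SlackTab} {kr : ℝ → ℝ} {H : HessTab} {F : ForceTab} {X : SlackTab} (hS : StretchRowEnclosure FamP (1 / 80) Kang kr H F X)
    (hC : StretchTubeCert FamP (1 / 80) sigmaOne Kang kr H F X) (hcov : CoverP) : CoreOffTubeFloor (63 / 10) (63 / 10) (24 / 5) (1 / 100) 0 :=
  coreOff_record_of_tubeP_of_coverP (tubeFloor_of_stretchCert forceCapOne hS hC) hcov

/-- ★★ **RECORD (stretch path, any cover tolerance `τ`)** — e.g. the `τ = 1/100` branch of row 1132 (BUDGET-T1 `2.5e4` core-h) or the empirical deg-3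
tolerance `τ = 1/118` of COVER-60, where the row slack drops to `3.3–5.3σ₁` / `2.7–3.9σ₁` (+ X). -/
theorem coreOff_record_g67_tau (τ : ℝ) {Kang : SlackTab} {kr : ℝ → ℝ} {H : HessTab} {F : ForceTab} {X : SlackTab} (hS : StretchRowEnclosure FamP τ Kang kr H F X)
    (hC : StretchTubeCert FamP τ sigmaOne Kang kr H F X) (hcov : FrustratedLawDichotomyStrainedPatchHostCells.FamilyCover FamP (24 / 5) (1 / 100) (1 / 8) τ) :
    CoreOffTubeFloor (63 / 10) (63 / 10) (24 / 5) (1 / 100) 0 :=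
  coreOff_of_tubeFloor_of_cover_eighth (tubeFloor_of_stretchCert forceCapOne hS hC) hcov

/-- ★ **RECORD (texture chain, `τ = 1/80`, inner ball `r ≤ 63/10`)** — the 66R path with its three ingredients explicit: (E1) rows [ANALYTIC, e.g.
`interiorRows_of_forceCap_of_rowEnclosure`] ∧ (E2) certificates `k i ↦ k (i+1)` [INSTRUMENTABLE, VOID from `k 0 = 2τ` by §2 unless the slack is
non-perturbative] ∧ (FT∇ᵢₙ r (k n)) [INSTRUMENTABLE] ∧ (BC)ᴾ.  At `n = 0` this is 66R's / 61H's record verbatim. -/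
theorem coreOff_record_g67_chain {r : ℝ} (hr : r ≤ 63 / 10) {H : HessTab} {F : ForceTab} {S : ℝ → SlackTab} (k : ℕ → ℝ) (n : ℕ) (h0 : k 0 = 2 * (1 / 80))
    (hR : InteriorRows FamP (1 / 80) H F S) (hs : ∀ i : ℕ, i < n → LinInteriorCert FamP (1 / 80) r H F S (k i) (k (i + 1)))
    (hC : RobustTubeCertIn FamP (1 / 80) r (k n)) (hcov : CoverP) : CoreOffTubeFloor (63 / 10) (63 / 10) (24 / 5) (1 / 100) 0 :=
  coreOff_record_of_tubeP_of_coverP (tubeFloor_of_relTextureIn_of_certIn (relTextureIn_of_chain_apriori hr k n h0 hR hs) hC) hcov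

end Summit.AtomisticToContinuum.Crystallization.Theorems.FrustratedLawDichotomyStrainedPatchStretchRows
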